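import Literature.NumberTheory.Transcendental.ZilberFieldGSGC
import Literature.NumberTheory.Transcendental.ZilberFieldQuasiminimalProps
import Literature.NumberTheory.Transcendental.ZilberProp112
import HarnessLib

/-!
# Quasiminimality of Zilber fields (proofs for `IsZilberField.isQuasiminimal` of `ZilberField.lean`)

Zilber 2005, Thm 1.2 / Bays–Kirby 2018, Thm 1.2 (= Thm 9.1): every Zilber field is quasiminimal
(`Literature.NumberTheory.Transcendental.IsZilberField.isQuasiminimal`, a named fact of
`ZilberField.lean`; this sibling file carries its proofs, which need imports far above
`ZilberField.lean`). In
`ZilberFieldQuasiminimalProps.lean` this was reduced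
(`IsZilberField.isQuasiminimal_of_prop_11_2`) to two inputs: Bays–Kirby's Prop. 11.2 (generic
strong Γ-closedness over a countable Γ-closed `K` ⟹ `ℵ₀`-saturation for Γ-algebraic extensions
over `K`, the named fact `Literature.NumberTheory.Transcendental.BaysKirby2018_prop_11_2`) and
generic strong Γ-closedness of uncountable Zilber fields over `ecl ∅`. The second input is now a
theorem — `IsZilberField.isGenericallyStronglyGammaClosedOver` of `ZilberFieldGSGC.lean` proves
GSΓC over *every* `K` from strong exponential-algebraic closedness — so the quasiminimality of
Zilber fields rests on Prop. 11.2 alone (`IsZilberField.isQuasiminimal_of_prop_11_2'`); the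
discharge `IsZilberField.isQuasiminimal_holds` is appended here once Prop. 11.2 is proved in the
tree.

## References

* B. Zilber, *Pseudo-exponentiation on algebraically closed fields of characteristic zero*,
  Ann. Pure Appl. Logic 132 (2005) 67–95, Thm 1.2, §5.
* M. Bays, J. Kirby, *Pseudo-exponential maps, variants, and quasiminimality*, Algebra & Number
  Theory 12 (2018) 493–549 (arXiv:1512.04262): Thm 1.2, Prop. 11.2, Prop. 11.5, Thm 11.6.
-/

namespace Literature.NumberTheory.Transcendental

universe u

/-- **Zilber fields are quasiminimal, granted Bays–Kirby's Prop. 11.2** (GSΓC over a countable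
Γ-closed `K` ⟹ `ℵ₀`-saturation, `BaysKirby2018_prop_11_2`): the generic strong Γ-closedness of
Zilber fields required by `IsZilberField.isQuasiminimal_of_prop_11_2` holds unconditionally
(`IsZilberField.isGenericallyStronglyGammaClosedOver`, from strong exponential-algebraic
closedness). [cite: Zilber2005PseudoExp, Thm 1.2] [cite: BaysKirby2018ANT, Thm 1.2, Prop. 11.2, Prop. 11.5] -/
theorem IsZilberField.isQuasiminimal_of_prop_11_2' (h2 : BaysKirby2018_prop_11_2.{u}) :
    IsZilberField.isQuasiminimal.{u} :=
  IsZilberField.isQuasiminimal_of_prop_11_2 h2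
    @fun _ _ _ _ _ hK => hK.isGenericallyStronglyGammaClosedOver _

/-- **Zilber fields are quasiminimal** (Zilber 2005, Thm 1.2; Bays–Kirby 2018, Thm 1.2 = Thm 9.1):
discharge of the named fact `IsZilberField.isQuasiminimal`, Bays–Kirby's Prop. 11.2 being proved
in the tree (`BaysKirby2018_prop_11_2_holds`, `ZilberProp112.lean`) and generic strong
Γ-closedness of Zilber fields being `IsZilberField.isGenericallyStronglyGammaClosedOver`
(`ZilberFieldGSGC.lean`). [cite: Zilber2005PseudoExp, Thm 1.2] [cite: BaysKirby2018ANT, Thm 1.2, Prop. 11.2] -/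
theorem IsZilberField.isQuasiminimal_holds : IsZilberField.isQuasiminimal.{u} :=
  IsZilberField.isQuasiminimal_of_prop_11_2' BaysKirby2018_prop_11_2_holds

end Literature.NumberTheory.Transcendental

/-! ### The weak form of Zilber's conjecture for `ℂ_exp`

Discharge of the named fact
`Literature.NumberTheory.Transcendental.zilberQuasiminimality_of_zilberConjecture` of
`Zilber.lean` (the strong form of Zilber's conjecture implies the weak one). It lives here rather
than in `Zilber.lean` / `ZilberProofs.lean` because `IsZilberField.isQuasiminimal_holds` sits far
above both in the import graph (`ZilberFieldQuasiminimalProps` → `ZilberQuasiminimalProofs` →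
`ZilberProofs` → `Zilber`). -/

namespace Literature.NumberTheory.Transcendental

/-- **Zilber's conjecture implies the quasiminimality of `ℂ_exp`** — discharge of the named fact
`zilberQuasiminimality_of_zilberConjecture` (`Zilber.lean`). Zilber 2005, Thm 1.2 / Bays–Kirby
2018, Thm 1.2: "Up to isomorphism there is exactly one model of the axioms `ECF_{SK,CCP}` of each
uncountable cardinality, and it is quasiminimal" — so the strong quasiminimality conjecture
(Bays–Kirby Conjecture 1.3, `ZilberConjecture = IsZilberField ℂ`: `ℂ_exp` is a model of
`ECF_{SK,CCP}`, i.e. `ℂ_exp ≅ 𝔹`) "evidently implies" the weak one (Conjecture 1.1,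
`Literature.ModelTheory.ExponentialFields.ZilberQuasiminimalityConjecture`: every subset of `ℂ`
definable with parameters in `⟨ℂ; +, ·, exp⟩` is countable or co-countable). Proof: every Zilber
field is quasiminimal (`IsZilberField.isQuasiminimal_holds`, proved above from Bays–Kirby
Prop. 11.2 and the generic strong Γ-closedness of Zilber fields), applied to `K = ℂ`; the weak
conjecture is literally `Language.expRing.IsQuasiminimal ℂ` (`zilberQuasiminimalityConjecture_iff`,
`Iff.rfl`). [cite: Zilber2005PseudoExp, Thm 1.2] [cite: BaysKirby2018ANT, Thm 1.2, Conjectures 1.1 and 1.3] -/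
theorem zilberQuasiminimality_of_zilberConjecture_holds :
    zilberQuasiminimality_of_zilberConjecture :=
  fun h => IsZilberField.isQuasiminimal_holds.{0} h

end Literature.NumberTheory.Transcendental
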